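/-
Copyright: the b2b-balaban T⁴-continuum CRUX team, row NE7b owner lineage `t4-ne7b-p1` (gen 114). Project licence.
-/
import Summits.QuantumFields.BalabanUV.T4Continuum.Spine.NE7b.HardStepChartRadius

/-!
# THE AUGMENTED MAP `h ↦ (D h, R h)` IS AN EQUIVALENCE WITH `‖T⁻¹ y‖ ≤ (C_H + C_Γ)‖y‖` FROM A SECTION AND A FIBRE INVERSE
# ALONE — IN ANY NORMED CURRENCY: `D ∘ H = 1`, `R ∘ H = 0` (the section is `R`-critical), `D ∘ Γ = 0`, `R ∘ Γ = 1` (the fibre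
# inverse) and uniqueness (`D h = 0 ∧ R h = 0 ⇒ h = 0`) give `T := (D, R) : E ≃L F × K` with `T⁻¹(w, κ) = H w + Γ κ`; the two
# chart letters `T`, `‖T⁻¹ y‖ ≤ N‖y‖` of `…HardStepChartRadius.exists_branch_chart` thereby hold in the sup ∕ mixed ∕ energy
# currency alike, and HSCR's branch follows with radius `(N⁻¹ − c)·r`, `N = C_H + C_Γ`
# (row NE7b, node U5c; the currency-free twin of `…AugmentedHessianEquivalence` — there `E` Hilbert, `R h = (Q h)|_{ker D}`, `N` from
# kernel coercivity; here the data are the columns themselves, as the sup column (48) ∕ (51) ∕ (52) supplies them on `ℤ^d`;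
# `…HardStepRadiusSupNorm`: «whether AHE can be run in a sup-norm currency is NOT HERE» — this is the abstract half; [folklore])

Cell `pub-balaban`, sub-cell `t4`, spine estimate NE7b (`T4WeightBudget.RelWeightBound`; the cell's OWN estimate — NOT PRINTED
in [Bałaban 1983–89], NOT PROVED).  Crux-route work under `Spine/NE7b/` by the row OWNER (`t4-ne7b-p1` gen 114) under FREEZE
(0)'s crux-prover clause (FILING-CLAIM C-ne7bp1-g114-2); NOTHING of Bałaban's is named as a Lean object, valued or asserted; no
`T4Continuum/Support` leaf typed; no `def`; zero `sorry`.  Imports: this row's `…HardStepChartRadius` (HSCR, leaf-03; Mathlib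
only behind it) — for §5's junction; §1–§4 are Mathlib-only linear algebra.

WHY (located).  The hard-step chain reads its chart through TWO letters (HSCR `exists_branch_chart` ∕ `exists_criticalBranch_chart`):
an equivalence `T : E ≃L F × K` linearising `(D, g)` and a pointwise inverse bound `‖T⁻¹ y‖ ≤ N‖y‖`; HSCR is typed on ANY complete
normed `E`.  The tree's supplier of these letters, `…AugmentedHessianEquivalence` (AHE), is HILBERT: `K = (ker D →L ℝ)`, `R h =
(Q h)|_{ker D}`, and `N = (1 + ‖Q‖∕m)‖M‖ + m⁻¹` from KERNEL COERCIVITY via Lax–Milgram.  Print's small-field regions are sup-norm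
balls (`…HardStepRadiusObstruction` ∕ `…HardStepRadiusSupNorm`: in `ℓ²` the radius letter `|t|·‖M₂‖ < 1` is impossible, in `ℓ^∞`
it is the condition `K₁ < L^{(d−2)∕2}`), and the owner's sup column typed the Gaussian skeleton's chart data in that currency:
the section `H` as a bounded operator on `ℓ^∞` ((48) `…OneShotChartSupOperator`), the fibre inverse `Γ = G′ − H·Q′G′` with
`Q′Γ = 0`, `AΓ ≡ 1 (mod Q′*)` and its sup letter ((51) `…FibreInverseSupNorm`), and uniqueness ((52) `…FibreSupUniqueness`:
Liouville in `ℓ^∞`).  What turns such columns into HSCR's two letters is currency-free linear algebra, typed here once: no inner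
product, no coercivity, no completeness (completeness re-enters only in §5, as HSCR's own hypothesis).  In the Hilbert currency
AHE's `T` is recovered with `H := T⁻¹(·, 0)`, `Γ := T⁻¹(0, ·)` (§4: the hypotheses are also NECESSARY).

WHAT IS PROVED ([folklore]; `E F K` real normed spaces; `D : E →L F`, `R : E →L K`, `H : F →L E`, `Γ : K →L E`; the four
identities `hDH : D (H w) = w`, `hRH : R (H w) = 0`, `hDΓ : D (Γ κ) = 0`, `hRΓ : R (Γ κ) = κ`; uniqueness `hU : D h = 0 → R h = 0 →
h = 0`):
* §1 `aug_section_add_fibre` (`(D, R)(H w + Γ κ) = (w, κ)`), `sub_columns_mem` (`h − (H(Dh) + Γ(Rh))` is killed by `D` and `R`),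
  **`eq_section_add_fibre`** (`hU` ⟹ `h = H (D h) + Γ (R h)` — the left-inverse identity), `unique_of_leftInverse` (conversely the
  identity gives `hU`), `eq_of_aug_eq` (`T₀ := (D, R)` is injective).
* §2 **`exists_aug_equiv`** (`∃ T : E ≃L F × K`, `T h = (D h, R h)`, `T⁻¹ (w, κ) = H w + Γ κ`), `norm_section_add_fibre_le`
  (`‖H w + Γ κ‖ ≤ (C_H + C_Γ)·‖(w, κ)‖` from the pointwise column letters), **`exists_aug_equiv_bound`** (`‖T⁻¹ y‖ ≤ (C_H + C_Γ)‖y‖`),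
  **`exists_aug_equiv_nnreal`** (HSCR's binders `T`, `hT`, `hN` VERBATIM for any `N : ℝ≥0` with `C_H + C_Γ ≤ N`),
  `exists_aug_equiv_opNorm` (`N = ‖H‖ + ‖Γ‖`).
* §3 the columns of ANY `T` reading `(D, R)`: `fst_symm`, `snd_symm`, `symm_inl_eq` ∕ `symm_inr_eq` (`T⁻¹(w,0) = H w`, `T⁻¹(0,κ) = Γ κ`
  under `hU`), `norm_symm_inl_le`, `norm_symm_inr_le`.
* §4 NECESSITY: `section_of_equiv` — any `T : E ≃L F × K` with `T h = (D h, R h)` yields `H := T⁻¹(·,0)`, `Γ := T⁻¹(0,·)` with the four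
  identities, uniqueness, and `C_H, C_Γ ≤ ‖T⁻¹‖`.
* §5 THE JUNCTION WITH HSCR: **`exists_branch_of_section_fibre`** — `E` complete nontrivial; the column data with letters
  `‖H w‖ ≤ C_H‖w‖`, `‖Γ κ‖ ≤ C_Γ‖κ‖`, `C_H + C_Γ ≤ N`; a transversal map `g : E → K` differentiable on `closedBall δ₀ r` with
  `‖Dg(x) − R‖ ≤ c < N⁻¹` ⟹ HSCR's branch `σ` of `g = g δ₀` points over `closedBall (Dδ₀) ((N⁻¹ − c)r)`, `D(σ w) = w`,
  `(N⁻¹ − c)⁻¹`-Lipschitz, unique on the `r`-ball — `exists_branch_chart` fed by §2, nothing else.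
* §6 toy: `E = ℝ × ℝ`, `D = fst`, `R = snd`, `H = inl`, `Γ = inr`.

NOT HERE (honest): the `ℓ^∞(ℤ^d)` INSTANTIATION on the Gaussian skeleton ((48) ∕ (51) ∕ (52) as `lp`-operators with `R := P_{ker Q′}∘A`
— the owner's (57), FILING-CLAIM C-ne7bp1-g114-3, leaf-06 first refusal); the values of `C_H`, `C_Γ` for print's covariant objects
((A3) ∕ (A1c), NC-NE7b-α UNRULED); the inductive step in a non-Hilbert currency (HSIS is Hilbert-typed); anything of Bałaban's.
BY-NAME EFFECT ON THE WALL: NONE.  NE7b NOT PRINTED ∕ NOT PROVED; spine PROVED 0∕9; rung (B)+1 on a FINITE torus — NOT infinite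
volume, NOT the mass gap, NOT Clay.  HONEST DEPENDENCY: continuum YM on T⁴ ⇐ BetaPertH ∧ nine spine estimates (0∕9 proved);
BetaPertH ⇐ (D1) ∧ (D4) ∧ CAP+tail; G-an2-4 gates asym, D1 and NE2∕3∕4.
-/

set_option autoImplicit false

noncomputable section

namespace Summit.QuantumFields.BalabanUV.T4Continuum.NE7b.AugmentedSectionFibreEquivalence

open Set Metric
open scoped NNReal

variable {E F K : Type*} [NormedAddCommGroup E] [NormedSpace ℝ E] [NormedAddCommGroup F] [NormedSpace ℝ F]
  [NormedAddCommGroup K] [NormedSpace ℝ K]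

/-! ## §1. The two columns and the left-inverse identity -/

/-- `(D, R)(H w + Γ κ) = (w, κ)`: the column map is a right inverse of the augmented map. [folklore] -/
theorem aug_section_add_fibre {D : E →L[ℝ] F} {R : E →L[ℝ] K} {H : F →L[ℝ] E} {Γ : K →L[ℝ] E}
    (hDH : ∀ w, D (H w) = w) (hRH : ∀ w, R (H w) = 0) (hDΓ : ∀ κ, D (Γ κ) = 0) (hRΓ : ∀ κ, R (Γ κ) = κ)
    (w : F) (κ : K) : (D.prod R) (H w + Γ κ) = (w, κ) := by
  rw [ContinuousLinearMap.prod_apply, map_add, map_add, hDH, hDΓ, hRH, hRΓ, add_zero, zero_add]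

/-- The defect `h − (H (D h) + Γ (R h))` is killed by `D` and by `R`. [folklore] -/
theorem sub_columns_mem {D : E →L[ℝ] F} {R : E →L[ℝ] K} {H : F →L[ℝ] E} {Γ : K →L[ℝ] E}
    (hDH : ∀ w, D (H w) = w) (hRH : ∀ w, R (H w) = 0) (hDΓ : ∀ κ, D (Γ κ) = 0) (hRΓ : ∀ κ, R (Γ κ) = κ) (h : E) :
    D (h - (H (D h) + Γ (R h))) = 0 ∧ R (h - (H (D h) + Γ (R h))) = 0 := by
  constructor
  · rw [map_sub, map_add, hDH, hDΓ, add_zero, sub_self]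
  · rw [map_sub, map_add, hRH, hRΓ, zero_add, sub_self]

/-- **THE LEFT-INVERSE IDENTITY**: under uniqueness, `h = H (D h) + Γ (R h)` for every `h`. [folklore] -/
theorem eq_section_add_fibre {D : E →L[ℝ] F} {R : E →L[ℝ] K} {H : F →L[ℝ] E} {Γ : K →L[ℝ] E}
    (hDH : ∀ w, D (H w) = w) (hRH : ∀ w, R (H w) = 0) (hDΓ : ∀ κ, D (Γ κ) = 0) (hRΓ : ∀ κ, R (Γ κ) = κ)
    (hU : ∀ h, D h = 0 → R h = 0 → h = 0) (h : E) : h = H (D h) + Γ (R h) := by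
  have hd := sub_columns_mem hDH hRH hDΓ hRΓ h
  exact sub_eq_zero.mp (hU _ hd.1 hd.2)

/-- Conversely, the left-inverse identity gives uniqueness. [folklore] -/
theorem unique_of_leftInverse {D : E →L[ℝ] F} {R : E →L[ℝ] K} {H : F →L[ℝ] E} {Γ : K →L[ℝ] E}
    (hL : ∀ h, H (D h) + Γ (R h) = h) (h : E) (hD : D h = 0) (hR : R h = 0) : h = 0 := by
  rw [← hL h, hD, hR, map_zero, map_zero, add_zero]

/-- The augmented map `(D, R)` is injective under uniqueness. [folklore] -/
theorem eq_of_aug_eq {D : E →L[ℝ] F} {R : E →L[ℝ] K} (hU : ∀ h, D h = 0 → R h = 0 → h = 0) {h h' : E}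
    (hD : D h = D h') (hR : R h = R h') : h = h' := by
  have h0 := hU (h - h') (by rw [map_sub, hD, sub_self]) (by rw [map_sub, hR, sub_self])
  exact sub_eq_zero.mp h0

/-! ## §2. The equivalence and its inverse bound -/

/-- **THE AUGMENTED MAP IS AN EQUIVALENCE**: `∃ T : E ≃L F × K` with `T h = (D h, R h)` and `T⁻¹ (w, κ) = H w + Γ κ` — no inner
product, no coercivity, no completeness. [folklore] -/
theorem exists_aug_equiv {D : E →L[ℝ] F} {R : E →L[ℝ] K} {H : F →L[ℝ] E} {Γ : K →L[ℝ] E}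
    (hDH : ∀ w, D (H w) = w) (hRH : ∀ w, R (H w) = 0) (hDΓ : ∀ κ, D (Γ κ) = 0) (hRΓ : ∀ κ, R (Γ κ) = κ)
    (hU : ∀ h, D h = 0 → R h = 0 → h = 0) :
    ∃ T : E ≃L[ℝ] F × K, (∀ h, T h = (D h, R h)) ∧ ∀ w κ, T.symm (w, κ) = H w + Γ κ := by
  set S : F × K →L[ℝ] E := H.comp (ContinuousLinearMap.fst ℝ F K) + Γ.comp (ContinuousLinearMap.snd ℝ F K) with hS
  have hSapply : ∀ y : F × K, S y = H y.1 + Γ y.2 := fun y => rfl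
  have hleft : Function.LeftInverse S (D.prod R) := fun h => by
    rw [hSapply]
    exact (eq_section_add_fibre hDH hRH hDΓ hRΓ hU h).symm
  have hright : Function.RightInverse S (D.prod R) := fun y => by
    rw [hSapply]
    exact aug_section_add_fibre hDH hRH hDΓ hRΓ y.1 y.2
  refine ⟨ContinuousLinearEquiv.equivOfInverse (D.prod R) S hleft hright, fun h => rfl, fun w κ => ?_⟩
  rw [ContinuousLinearEquiv.symm_equivOfInverse, ContinuousLinearEquiv.equivOfInverse_apply, hSapply]

/-- The column bound: `‖H w + Γ κ‖ ≤ (C_H + C_Γ)·‖(w, κ)‖` (sup norm on the product). [folklore] -/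
theorem norm_section_add_fibre_le {H : F →L[ℝ] E} {Γ : K →L[ℝ] E} {CH CΓ : ℝ} (hCH : 0 ≤ CH) (hCΓ : 0 ≤ CΓ)
    (hH : ∀ w, ‖H w‖ ≤ CH * ‖w‖) (hΓ : ∀ κ, ‖Γ κ‖ ≤ CΓ * ‖κ‖) (y : F × K) :
    ‖H y.1 + Γ y.2‖ ≤ (CH + CΓ) * ‖y‖ := by
  calc ‖H y.1 + Γ y.2‖ ≤ ‖H y.1‖ + ‖Γ y.2‖ := norm_add_le _ _
    _ ≤ CH * ‖y.1‖ + CΓ * ‖y.2‖ := add_le_add (hH y.1) (hΓ y.2)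
    _ ≤ CH * ‖y‖ + CΓ * ‖y‖ :=
        add_le_add (mul_le_mul_of_nonneg_left (norm_fst_le y) hCH) (mul_le_mul_of_nonneg_left (norm_snd_le y) hCΓ)
    _ = (CH + CΓ) * ‖y‖ := by ring

/-- **THE INVERSE BOUND FROM THE COLUMN LETTERS**: `‖H w‖ ≤ C_H‖w‖`, `‖Γ κ‖ ≤ C_Γ‖κ‖` ⟹ `‖T⁻¹ y‖ ≤ (C_H + C_Γ)‖y‖` for the
equivalence of `exists_aug_equiv`. [folklore] -/
theorem exists_aug_equiv_bound {D : E →L[ℝ] F} {R : E →L[ℝ] K} {H : F →L[ℝ] E} {Γ : K →L[ℝ] E}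
    (hDH : ∀ w, D (H w) = w) (hRH : ∀ w, R (H w) = 0) (hDΓ : ∀ κ, D (Γ κ) = 0) (hRΓ : ∀ κ, R (Γ κ) = κ)
    (hU : ∀ h, D h = 0 → R h = 0 → h = 0) {CH CΓ : ℝ} (hCH : 0 ≤ CH) (hCΓ : 0 ≤ CΓ)
    (hH : ∀ w, ‖H w‖ ≤ CH * ‖w‖) (hΓ : ∀ κ, ‖Γ κ‖ ≤ CΓ * ‖κ‖) :
    ∃ T : E ≃L[ℝ] F × K, (∀ h, T h = (D h, R h)) ∧ (∀ w κ, T.symm (w, κ) = H w + Γ κ) ∧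
      ∀ y, ‖T.symm y‖ ≤ (CH + CΓ) * ‖y‖ := by
  obtain ⟨T, hT, hsymm⟩ := exists_aug_equiv hDH hRH hDΓ hRΓ hU
  refine ⟨T, hT, hsymm, fun y => ?_⟩
  rw [← Prod.mk.eta (p := y), hsymm]
  exact norm_section_add_fibre_le hCH hCΓ hH hΓ y

/-- **HSCR's BINDERS VERBATIM**: for any `N : ℝ≥0` with `C_H + C_Γ ≤ N`,
`∃ T, (∀ h, T h = (D h, R h)) ∧ ∀ y, ‖T.symm y‖ ≤ N * ‖y‖` (the smallness letter then reads `c < N⁻¹`). [folklore] -/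
theorem exists_aug_equiv_nnreal {D : E →L[ℝ] F} {R : E →L[ℝ] K} {H : F →L[ℝ] E} {Γ : K →L[ℝ] E}
    (hDH : ∀ w, D (H w) = w) (hRH : ∀ w, R (H w) = 0) (hDΓ : ∀ κ, D (Γ κ) = 0) (hRΓ : ∀ κ, R (Γ κ) = κ)
    (hU : ∀ h, D h = 0 → R h = 0 → h = 0) {CH CΓ : ℝ} (hCH : 0 ≤ CH) (hCΓ : 0 ≤ CΓ)
    (hH : ∀ w, ‖H w‖ ≤ CH * ‖w‖) (hΓ : ∀ κ, ‖Γ κ‖ ≤ CΓ * ‖κ‖) {N : ℝ≥0} (hN : CH + CΓ ≤ (N : ℝ)) :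
    ∃ T : E ≃L[ℝ] F × K, (∀ h, T h = (D h, R h)) ∧ ∀ y : F × K, ‖T.symm y‖ ≤ N * ‖y‖ := by
  obtain ⟨T, hT, -, hb⟩ := exists_aug_equiv_bound hDH hRH hDΓ hRΓ hU hCH hCΓ hH hΓ
  exact ⟨T, hT, fun y => (hb y).trans (mul_le_mul_of_nonneg_right hN (norm_nonneg y))⟩

/-- The operator-norm reading: `N = ‖H‖ + ‖Γ‖`. [folklore] -/
theorem exists_aug_equiv_opNorm {D : E →L[ℝ] F} {R : E →L[ℝ] K} {H : F →L[ℝ] E} {Γ : K →L[ℝ] E}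
    (hDH : ∀ w, D (H w) = w) (hRH : ∀ w, R (H w) = 0) (hDΓ : ∀ κ, D (Γ κ) = 0) (hRΓ : ∀ κ, R (Γ κ) = κ)
    (hU : ∀ h, D h = 0 → R h = 0 → h = 0) :
    ∃ T : E ≃L[ℝ] F × K, (∀ h, T h = (D h, R h)) ∧ ∀ y : F × K, ‖T.symm y‖ ≤ (‖H‖ + ‖Γ‖) * ‖y‖ := by
  obtain ⟨T, hT, -, hb⟩ := exists_aug_equiv_bound hDH hRH hDΓ hRΓ hU (norm_nonneg H) (norm_nonneg Γ)
    (fun w => H.le_opNorm w) (fun κ => Γ.le_opNorm κ)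
  exact ⟨T, hT, hb⟩

/-! ## §3. The columns of any `T` reading `(D, R)` -/

/-- `D (T⁻¹ y) = y.1`. [folklore] -/
theorem fst_symm {D : E →L[ℝ] F} {R : E →L[ℝ] K} (T : E ≃L[ℝ] F × K) (hT : ∀ h, T h = (D h, R h)) (y : F × K) :
    D (T.symm y) = y.1 := by
  have e := hT (T.symm y)
  rw [ContinuousLinearEquiv.apply_symm_apply] at e
  exact (congrArg Prod.fst e).symm

/-- `R (T⁻¹ y) = y.2`. [folklore] -/
theorem snd_symm {D : E →L[ℝ] F} {R : E →L[ℝ] K} (T : E ≃L[ℝ] F × K) (hT : ∀ h, T h = (D h, R h)) (y : F × K) :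
    R (T.symm y) = y.2 := by
  have e := hT (T.symm y)
  rw [ContinuousLinearEquiv.apply_symm_apply] at e
  exact (congrArg Prod.snd e).symm

/-- THE `(w, 0)` COLUMN IS THE SECTION: `T⁻¹ (w, 0) = H w` (under uniqueness). [folklore] -/
theorem symm_inl_eq {D : E →L[ℝ] F} {R : E →L[ℝ] K} {H : F →L[ℝ] E} (hDH : ∀ w, D (H w) = w) (hRH : ∀ w, R (H w) = 0)
    (hU : ∀ h, D h = 0 → R h = 0 → h = 0) (T : E ≃L[ℝ] F × K) (hT : ∀ h, T h = (D h, R h)) (w : F) :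
    T.symm (w, 0) = H w :=
  eq_of_aug_eq hU (by rw [fst_symm T hT, hDH]) (by rw [snd_symm T hT, hRH])

/-- THE `(0, κ)` COLUMN IS THE FIBRE INVERSE: `T⁻¹ (0, κ) = Γ κ` (under uniqueness). [folklore] -/
theorem symm_inr_eq {D : E →L[ℝ] F} {R : E →L[ℝ] K} {Γ : K →L[ℝ] E} (hDΓ : ∀ κ, D (Γ κ) = 0) (hRΓ : ∀ κ, R (Γ κ) = κ)
    (hU : ∀ h, D h = 0 → R h = 0 → h = 0) (T : E ≃L[ℝ] F × K) (hT : ∀ h, T h = (D h, R h)) (κ : K) :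
    T.symm (0, κ) = Γ κ :=
  eq_of_aug_eq hU (by rw [fst_symm T hT, hDΓ]) (by rw [snd_symm T hT, hRΓ])

/-- `‖T⁻¹ (w, 0)‖ ≤ C_H‖w‖`. [folklore] -/
theorem norm_symm_inl_le {D : E →L[ℝ] F} {R : E →L[ℝ] K} {H : F →L[ℝ] E} (hDH : ∀ w, D (H w) = w)
    (hRH : ∀ w, R (H w) = 0) (hU : ∀ h, D h = 0 → R h = 0 → h = 0) (T : E ≃L[ℝ] F × K) (hT : ∀ h, T h = (D h, R h))
    {CH : ℝ} (hH : ∀ w, ‖H w‖ ≤ CH * ‖w‖) (w : F) : ‖T.symm (w, 0)‖ ≤ CH * ‖w‖ := by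
  rw [symm_inl_eq hDH hRH hU T hT]
  exact hH w

/-- `‖T⁻¹ (0, κ)‖ ≤ C_Γ‖κ‖`. [folklore] -/
theorem norm_symm_inr_le {D : E →L[ℝ] F} {R : E →L[ℝ] K} {Γ : K →L[ℝ] E} (hDΓ : ∀ κ, D (Γ κ) = 0)
    (hRΓ : ∀ κ, R (Γ κ) = κ) (hU : ∀ h, D h = 0 → R h = 0 → h = 0) (T : E ≃L[ℝ] F × K) (hT : ∀ h, T h = (D h, R h))
    {CΓ : ℝ} (hΓ : ∀ κ, ‖Γ κ‖ ≤ CΓ * ‖κ‖) (κ : K) : ‖T.symm (0, κ)‖ ≤ CΓ * ‖κ‖ := by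
  rw [symm_inr_eq hDΓ hRΓ hU T hT]
  exact hΓ κ

/-! ## §4. Necessity: any equivalence reading `(D, R)` comes from such columns -/

/-- **THE HYPOTHESES ARE NECESSARY**: if some `T : E ≃L F × K` reads `(D, R)`, then `H := T⁻¹(·, 0)` and `Γ := T⁻¹(0, ·)` are a
section and a fibre inverse with the four identities, uniqueness holds, and both columns are bounded by `‖T⁻¹‖` — in particular AHE's
Hilbert `T` is the `(H, Γ)` of this file with `R h = (Q h)|_{ker D}`. [folklore] -/
theorem section_of_equiv {D : E →L[ℝ] F} {R : E →L[ℝ] K} (T : E ≃L[ℝ] F × K) (hT : ∀ h, T h = (D h, R h)) :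
    ∃ (H : F →L[ℝ] E) (Γ : K →L[ℝ] E),
      (∀ w, D (H w) = w) ∧ (∀ w, R (H w) = 0) ∧ (∀ κ, D (Γ κ) = 0) ∧ (∀ κ, R (Γ κ) = κ) ∧
      (∀ h, D h = 0 → R h = 0 → h = 0) ∧ (∀ w κ, T.symm (w, κ) = H w + Γ κ) ∧
      (∀ w, ‖H w‖ ≤ ‖(T.symm : F × K →L[ℝ] E)‖ * ‖w‖) ∧ (∀ κ, ‖Γ κ‖ ≤ ‖(T.symm : F × K →L[ℝ] E)‖ * ‖κ‖) := by
  set H : F →L[ℝ] E := (T.symm : F × K →L[ℝ] E).comp (ContinuousLinearMap.inl ℝ F K) with hH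
  set Γ : K →L[ℝ] E := (T.symm : F × K →L[ℝ] E).comp (ContinuousLinearMap.inr ℝ F K) with hΓ
  have hHapply : ∀ w, H w = T.symm (w, 0) := fun w => rfl
  have hΓapply : ∀ κ, Γ κ = T.symm (0, κ) := fun κ => rfl
  refine ⟨H, Γ, fun w => ?_, fun w => ?_, fun κ => ?_, fun κ => ?_, fun h hD hR => ?_, fun w κ => ?_, fun w => ?_, fun κ => ?_⟩
  · rw [hHapply, fst_symm T hT]
  · rw [hHapply, snd_symm T hT]
  · rw [hΓapply, fst_symm T hT]
  · rw [hΓapply, snd_symm T hT]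
  · have e : T h = 0 := by rw [hT h, hD, hR]; rfl
    simpa using congrArg T.symm e
  · rw [hHapply, hΓapply, ← map_add, Prod.mk_add_mk, add_zero, zero_add]
  · rw [hHapply]
    refine ((T.symm : F × K →L[ℝ] E).le_opNorm (w, 0)).trans (mul_le_mul_of_nonneg_left ?_ (norm_nonneg _))
    rw [Prod.norm_def, norm_zero, max_eq_left (norm_nonneg w)]
  · rw [hΓapply]
    refine ((T.symm : F × K →L[ℝ] E).le_opNorm (0, κ)).trans (mul_le_mul_of_nonneg_left ?_ (norm_nonneg _))
    rw [Prod.norm_def, norm_zero, max_eq_right (norm_nonneg κ)]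

/-! ## §5. The junction with HSCR: the branch from the columns -/

/-- **THE BRANCH FROM A SECTION AND A FIBRE INVERSE, IN ANY COMPLETE CURRENCY.**  `E` complete nontrivial; `D`, `R`, `H`, `Γ` with
the four identities and uniqueness; column letters `‖H w‖ ≤ C_H‖w‖`, `‖Γ κ‖ ≤ C_Γ‖κ‖`, `C_H + C_Γ ≤ N`; a transversal map
`g : E → K` differentiable on `closedBall δ₀ r` with `‖Dg(x) − R‖ ≤ c` there and `c < N⁻¹` ⟹ a branch `σ : F → E` of `g = g δ₀`
points, `σ (Dδ₀) = δ₀`, `D(σ w) = w`, `σ w ∈ closedBall δ₀ r` on `closedBall (Dδ₀) ((N⁻¹ − c)r)`, `(N⁻¹ − c)⁻¹`-Lipschitz there, unique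
on the `r`-ball — HSCR `exists_branch_chart` with §2's `T`. [folklore] -/
theorem exists_branch_of_section_fibre [CompleteSpace E] [Nontrivial E]
    (D : E →L[ℝ] F) (R : E →L[ℝ] K) {H : F →L[ℝ] E} {Γ : K →L[ℝ] E}
    (hDH : ∀ w, D (H w) = w) (hRH : ∀ w, R (H w) = 0) (hDΓ : ∀ κ, D (Γ κ) = 0) (hRΓ : ∀ κ, R (Γ κ) = κ)
    (hU : ∀ h, D h = 0 → R h = 0 → h = 0) {CH CΓ : ℝ} (hCH : 0 ≤ CH) (hCΓ : 0 ≤ CΓ)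
    (hHb : ∀ w, ‖H w‖ ≤ CH * ‖w‖) (hΓb : ∀ κ, ‖Γ κ‖ ≤ CΓ * ‖κ‖) {N c : ℝ≥0} (hN : CH + CΓ ≤ (N : ℝ)) (hc : c < N⁻¹)
    {g : E → K} {δ₀ : E} {r : ℝ} (hr : 0 ≤ r)
    (hg : ∀ x ∈ closedBall δ₀ r, DifferentiableAt ℝ g x) (hgc : ∀ x ∈ closedBall δ₀ r, ‖fderiv ℝ g x - R‖ ≤ c) :
    ∃ σ : F → E, σ (D δ₀) = δ₀ ∧
      (∀ w ∈ closedBall (D δ₀) (((N : ℝ)⁻¹ - c) * r), σ w ∈ closedBall δ₀ r ∧ D (σ w) = w ∧ g (σ w) = g δ₀) ∧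
      LipschitzOnWith (N⁻¹ - c)⁻¹ σ (closedBall (D δ₀) (((N : ℝ)⁻¹ - c) * r)) ∧
      (∀ δ ∈ closedBall δ₀ r, g δ = g δ₀ → σ (D δ) = δ) := by
  obtain ⟨T, hT, hTN⟩ := exists_aug_equiv_nnreal hDH hRH hDΓ hRΓ hU hCH hCΓ hHb hΓb hN
  exact HardStepChartRadius.exists_branch_chart D R T hT hr hTN hc hg hgc

/-! ## §6. Toy -/

/-- Toy: `E = ℝ × ℝ`, `D = fst`, `R = snd`, section `inl`, fibre inverse `inr`: the four identities and uniqueness hold, so §2 gives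
the (identity) equivalence with `‖T⁻¹ y‖ ≤ (1 + 1)‖y‖`. -/
example : ∃ T : (ℝ × ℝ) ≃L[ℝ] ℝ × ℝ,
    (∀ h, T h = ((ContinuousLinearMap.fst ℝ ℝ ℝ) h, (ContinuousLinearMap.snd ℝ ℝ ℝ) h)) ∧
      ∀ y : ℝ × ℝ, ‖T.symm y‖ ≤ (2 : ℝ≥0) * ‖y‖ := by
  refine exists_aug_equiv_nnreal (D := ContinuousLinearMap.fst ℝ ℝ ℝ) (R := ContinuousLinearMap.snd ℝ ℝ ℝ)
    (H := ContinuousLinearMap.inl ℝ ℝ ℝ) (Γ := ContinuousLinearMap.inr ℝ ℝ ℝ)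
    (fun w => rfl) (fun w => rfl) (fun κ => rfl) (fun κ => rfl) (fun h hD hR => Prod.ext hD hR)
    (CH := 1) (CΓ := 1) zero_le_one zero_le_one (fun w => ?_) (fun κ => ?_) (by norm_num)
  · rw [ContinuousLinearMap.inl_apply, Prod.norm_def, norm_zero, max_eq_left (norm_nonneg w), one_mul]
  · rw [ContinuousLinearMap.inr_apply, Prod.norm_def, norm_zero, max_eq_right (norm_nonneg κ), one_mul]

end Summit.QuantumFields.BalabanUV.T4Continuum.NE7b.AugmentedSectionFibreEquivalence

end
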